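import Literature.RepresentationTheory.IsotypicFamilyPeel
import Mathlib.RingTheory.Flat.FaithfullyFlat.Basic
import HarnessLib

/-!
# Rigidity of a finite commuting family of isotypic actions: irreducibles with the same local types are isomorphic

Topic `RepresentationTheory`; namespace `Literature.RepresentationTheory`.  THEOREMS ONLY, sequel of `IsotypicFamilyPeel`.

Let `k` be a field, `G i` groups, `S` a FINITE set of indices, and `X`, `Y` two `k`-spaces each carrying a pairwise commuting
family of representations `ρ i`, `ρ' i` (`i ∈ S`) such that for every `i ∈ S` both `ρ i` and `ρ' i` are isotypic of the same
irreducible type `τ i` with scalar commutant.  If `X` and `Y` are IRREDUCIBLE for their families (non-trivial, no proper non-zero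
subspace stable under all `ρ i g`, `i ∈ S`), then there is an INJECTIVE family-equivariant `k`-linear map `X → Y`
(`exists_injective_equivariant_of_isotypic_family`; by symmetry and irreducibility it is an isomorphism, which we do not
need).  Induction on `S` through the peel `X ≅ τ_j ⊗ Hom_{G_j}(τ_j, X)` (★ `exists_peel`): the multiplicity spaces are again
irreducible for the remaining family (faithful flatness of `τ_j ⊗ −` over a field, Mathlib `Module.FaithfullyFlat`) and of the
same types, and `ψ = e' ∘ (1 ⊗ ψ_M) ∘ e⁻¹`.  This is the «uniquely determined `M` and `N`» clause of Bump 1997, Prop. 3.4.2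
(Bourbaki, *Algèbre* VIII §7.7) for finitely many factors and infinite-dimensional modules with scalar commutants — the
finite-product case of the uniqueness half of Flath's tensor product theorem (Flath 1979, Thm. 1 ∕ Thm. 3).

## References
* D. Bump, *Automorphic Forms and Representations* (1997), Prop. 3.4.2 (uniqueness of the factors), Thm. 3.4.4.
* D. Flath, *Decomposition of representations into tensor products*, PSPM 33.1 (1979), Thm. 1, Thm. 3.
-/

set_option autoImplicit false

noncomputable section

open TensorProduct
open scoped MonoidAlgebra

namespace Literature.RepresentationTheory

universe u uk uι uG

variable {k : Type uk} [Field k] {ι : Type uι} [DecidableEq ι] {G : ι → Type uG} [∀ i, Group (G i)]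

/-- A one-dimensional-type space: if `X` is non-trivial and its only subspaces are `⊥` and `⊤`, then `X = k x₀` for any
`x₀ ≠ 0`. [folklore] -/
private theorem span_singleton_eq_top_of_forall {X : Type u} [AddCommGroup X] [Module k X]
    (hX : ∀ Z : Submodule k X, Z = ⊥ ∨ Z = ⊤) {x₀ : X} (hx₀ : x₀ ≠ 0) : Submodule.span k {x₀} = ⊤ :=
  (hX _).resolve_left fun h => hx₀ (by simpa [Submodule.span_singleton_eq_bot] using h)

/-- **Rigidity of a finite commuting isotypic family.**  `X`, `Y` irreducible for commuting families `ρ`, `ρ'` indexed by the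
finite set `S`, of the same irreducible scalar-commutant types `τ i` (`i ∈ S`): there is an injective `k`-linear `ψ : X → Y`
with `ψ ∘ ρ i g = ρ' i g ∘ ψ` for all `i ∈ S`. (Bump 1997, Prop. 3.4.2, uniqueness of the tensor factors; Flath 1979, Thm. 1.)
[cite: Bump1997, Prop. 3.4.2] -/
theorem exists_injective_equivariant_of_isotypic_family (S : Finset ι) {T : ι → Type u} [∀ i, AddCommGroup (T i)]
    [∀ i, Module k (T i)] (τ : ∀ i, Representation k (G i) (T i)) [∀ i, (τ i).IsIrreducible]
    (hτ : ∀ i ∈ S, ∀ φ : (τ i).IntertwiningMap (τ i), ∃ c : k, ∀ x, φ x = c • x) :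
    ∀ (X Y : Type u) [AddCommGroup X] [Module k X] [AddCommGroup Y] [Module k Y]
      (ρ : ∀ i, Representation k (G i) X) (ρ' : ∀ i, Representation k (G i) Y),
      (∀ i i', i ≠ i' → ∀ (g : G i) (g' : G i') (x : X), ρ i g (ρ i' g' x) = ρ i' g' (ρ i g x)) →
      (∀ i i', i ≠ i' → ∀ (g : G i) (g' : G i') (y : Y), ρ' i g (ρ' i' g' y) = ρ' i' g' (ρ' i g y)) →
      (∀ i ∈ S, isotypicComponent k[G i] (ρ i).asModule (τ i).asModule = ⊤) →
      (∀ i ∈ S, isotypicComponent k[G i] (ρ' i).asModule (τ i).asModule = ⊤) →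
      Nontrivial X → (∀ Z : Submodule k X, (∀ i ∈ S, ∀ (g : G i), ∀ z ∈ Z, ρ i g z ∈ Z) → Z = ⊥ ∨ Z = ⊤) →
      Nontrivial Y → (∀ Z : Submodule k Y, (∀ i ∈ S, ∀ (g : G i), ∀ z ∈ Z, ρ' i g z ∈ Z) → Z = ⊥ ∨ Z = ⊤) →
        ∃ ψ : X →ₗ[k] Y, Function.Injective ψ ∧ ∀ i ∈ S, ∀ (g : G i) (x : X), ψ (ρ i g x) = ρ' i g (ψ x) := by
  classical
  induction S using Finset.induction_on with
  | empty =>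
    intro X Y _ _ _ _ ρ ρ' _ _ _ _ hX hXirr hY hYirr
    obtain ⟨x₀, hx₀⟩ := exists_ne (0 : X)
    obtain ⟨y₀, hy₀⟩ := exists_ne (0 : Y)
    have hXtop := span_singleton_eq_top_of_forall (fun Z => hXirr Z fun i hi => absurd hi (Finset.notMem_empty i)) hx₀
    let e₁ : k ≃ₗ[k] X := (LinearEquiv.toSpanNonzeroSingleton k X x₀ hx₀).trans (LinearEquiv.ofTop _ hXtop)
    refine ⟨(LinearMap.toSpanSingleton k Y y₀).comp e₁.symm.toLinearMap, ?_, fun i hi => absurd hi (Finset.notMem_empty i)⟩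
    refine (injective_iff_map_eq_zero _).2 fun x hx => ?_
    rw [LinearMap.comp_apply, LinearMap.toSpanSingleton_apply, smul_eq_zero] at hx
    rcases hx with h | h
    · simpa using congrArg e₁ h
    · exact absurd h hy₀
  | insert j S' hj IH =>
    intro X Y _ _ _ _ ρ ρ' hcomm hcomm' hiso hiso' hX hXirr hY hYirr
    have hjS : j ∈ insert j S' := Finset.mem_insert_self j S'
    have hS'S : ∀ i ∈ S', i ∈ insert j S' := fun i hi => Finset.mem_insert_of_mem hi
    have hS'j : ∀ i ∈ S', i ≠ j := fun i hi => ne_of_mem_of_not_mem hi hj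
    haveI : Nontrivial (T j) := by
      haveI : IsSimpleModule k[G j] (τ j).asModule := inferInstance
      exact IsSimpleModule.nontrivial k[G j] (τ j).asModule
    -- peel both spaces at `j`
    obtain ⟨M, _, _, ρM, e, Φ, he_j, he_i, -, hMcomm, -, -, hMiso⟩ := exists_peel ρ hcomm j (τ j) (hτ j hjS) (hiso j hjS)
    obtain ⟨M', _, _, ρM', e', Φ', he'_j, he'_i, -, hM'comm, -, -, hM'iso⟩ :=
      exists_peel ρ' hcomm' j (τ j) (hτ j hjS) (hiso' j hjS)
    -- equivariance of `e`, `e'` on all tensors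
    have heq_j : ∀ (g : G j) (z : T j ⊗[k] M), e ((τ j g).rTensor M z) = ρ j g (e z) := fun g z => by
      induction z using TensorProduct.induction_on with
      | zero => simp
      | tmul t m => rw [LinearMap.rTensor_tmul, he_j]
      | add a b ha hb => rw [map_add, map_add, ha, hb, map_add, map_add]
    have heq_i : ∀ i, i ≠ j → ∀ (g : G i) (z : T j ⊗[k] M), e ((ρM i g).lTensor (T j) z) = ρ i g (e z) := fun i hij g z => by
      induction z using TensorProduct.induction_on with
      | zero => simp
      | tmul t m => rw [LinearMap.lTensor_tmul, he_i i hij]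
      | add a b ha hb => rw [map_add, map_add, ha, hb, map_add, map_add]
    have heq'_j : ∀ (g : G j) (z : T j ⊗[k] M'), e' ((τ j g).rTensor M' z) = ρ' j g (e' z) := fun g z => by
      induction z using TensorProduct.induction_on with
      | zero => simp
      | tmul t m => rw [LinearMap.rTensor_tmul, he'_j]
      | add a b ha hb => rw [map_add, map_add, ha, hb, map_add, map_add]
    have heq'_i : ∀ i, i ≠ j → ∀ (g : G i) (z : T j ⊗[k] M'), e' ((ρM' i g).lTensor (T j) z) = ρ' i g (e' z) :=
      fun i hij g z => by
      induction z using TensorProduct.induction_on with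
      | zero => simp
      | tmul t m => rw [LinearMap.lTensor_tmul, he'_i i hij]
      | add a b ha hb => rw [map_add, map_add, ha, hb, map_add, map_add]
    -- the multiplicity spaces are non-trivial and irreducible for `S'`
    have irr : ∀ (Xx : Type u) [AddCommGroup Xx] [Module k Xx] (ρx : ∀ i, Representation k (G i) Xx)
        (Mx : Type u) [AddCommGroup Mx] [Module k Mx] (ρMx : ∀ i, Representation k (G i) Mx) (ex : T j ⊗[k] Mx ≃ₗ[k] Xx),
        (∀ (g : G j) (z : T j ⊗[k] Mx), ex ((τ j g).rTensor Mx z) = ρx j g (ex z)) →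
        (∀ i, i ≠ j → ∀ (g : G i) (z : T j ⊗[k] Mx), ex ((ρMx i g).lTensor (T j) z) = ρx i g (ex z)) →
        Nontrivial Xx →
        (∀ Z : Submodule k Xx, (∀ i ∈ insert j S', ∀ (g : G i), ∀ z ∈ Z, ρx i g z ∈ Z) → Z = ⊥ ∨ Z = ⊤) →
        Nontrivial Mx ∧ ∀ N : Submodule k Mx, (∀ i ∈ S', ∀ (g : G i), ∀ n ∈ N, ρMx i g n ∈ N) → N = ⊥ ∨ N = ⊤ := by
      intro Xx _ _ ρx Mx _ _ ρMx ex hexj hexi hXx hXxirr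
      have hMx : Nontrivial Mx := by
        haveI : Nontrivial (T j ⊗[k] Mx) := ex.toEquiv.nontrivial
        exact (Module.FaithfullyFlat.nontrivial_tensorProduct_iff_right k (T j) (N := Mx)).1 inferInstance
      refine ⟨hMx, fun N hN => ?_⟩
      -- the image `e (T ⊗ N)` is stable under the whole family, hence `⊥` or `⊤`
      let Z : Submodule k Xx := (LinearMap.range (N.subtype.lTensor (T j))).map (ex : T j ⊗[k] Mx →ₗ[k] Xx)
      have hZ : ∀ i ∈ insert j S', ∀ (g : G i), ∀ z ∈ Z, ρx i g z ∈ Z := by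
        rintro i hi g _ ⟨w, ⟨y, rfl⟩, rfl⟩
        rw [LinearEquiv.coe_coe]
        rcases Finset.mem_insert.1 hi with rfl | hi'
        · refine ⟨(τ i g).rTensor Mx (N.subtype.lTensor (T i) y), ⟨(τ i g).rTensor N y, ?_⟩, hexj g _⟩
          rw [← LinearMap.comp_apply, ← LinearMap.comp_apply, LinearMap.rTensor_comp_lTensor,
            ← LinearMap.lTensor_comp_rTensor]
        · have hij : i ≠ j := ne_of_mem_of_not_mem hi' hj
          refine ⟨(ρMx i g).lTensor (T j) (N.subtype.lTensor (T j) y),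
            ⟨((ρMx i g).restrict fun n hn => hN i hi' g n hn).lTensor (T j) y, ?_⟩, hexi i hij g _⟩
          rw [← LinearMap.comp_apply, ← LinearMap.comp_apply, ← LinearMap.lTensor_comp, ← LinearMap.lTensor_comp]
          rfl
      rcases hXxirr Z hZ with hbot | htop
      · -- `T ⊗ N → T ⊗ M` is zero, so `N = ⊥` (faithful flatness)
        left
        have hzero : N.subtype.lTensor (T j) = 0 := by
          apply LinearMap.ext
          intro y
          have : ex (N.subtype.lTensor (T j) y) ∈ Z := ⟨_, ⟨y, rfl⟩, rfl⟩
          rw [hbot, Submodule.mem_bot, map_eq_zero_iff _ ex.injective] at this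
          exact this
        have hinj : Function.Injective (N.subtype.lTensor (T j)) :=
          (Module.FaithfullyFlat.lTensor_injective_iff_injective k (T j) N.subtype).2 N.subtype_injective
        rw [eq_bot_iff]
        intro n hn
        have h0 : N.subtype.lTensor (T j) ((exists_ne (0 : T j)).choose ⊗ₜ[k] ⟨n, hn⟩) = 0 := by rw [hzero]; rfl
        have := hinj (h0.trans (map_zero _).symm)
        rw [Submodule.mem_bot]
        have ht := (exists_ne (0 : T j)).choose_spec
        -- `t ⊗ n = 0` with `t ≠ 0` forces `n = 0`
        obtain ⟨f, hf⟩ := Module.Projective.exists_dual_eq_one k ht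
        have h2 := congrArg (fun z => TensorProduct.lid k N (f.rTensor N z)) this
        simp only [LinearMap.rTensor_tmul, TensorProduct.lid_tmul, hf, one_smul, map_zero] at h2
        simpa using congrArg Subtype.val h2
      · -- `T ⊗ N → T ⊗ M` is onto, so `N = ⊤` (faithful flatness)
        right
        have hsurj : Function.Surjective (N.subtype.lTensor (T j)) := by
          intro z
          have hz : ex z ∈ Z := by rw [htop]; trivial
          obtain ⟨w, ⟨y, rfl⟩, hw⟩ := hz
          exact ⟨y, ex.injective hw⟩
        have := (Module.FaithfullyFlat.lTensor_surjective_iff_surjective k (T j) N.subtype).1 hsurj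
        rw [eq_top_iff]
        intro m _
        obtain ⟨n, rfl⟩ := this m
        exact n.2
    obtain ⟨hMnt, hMirr⟩ := irr X ρ M ρM e heq_j heq_i hX hXirr
    obtain ⟨hM'nt, hM'irr⟩ := irr Y ρ' M' ρM' e' heq'_j heq'_i hY hYirr
    -- induction hypothesis on the multiplicity spaces
    obtain ⟨ψM, hψMinj, hψM⟩ := IH (fun i hi => hτ i (hS'S i hi)) M M' ρM ρM' hMcomm hM'comm
      (fun i hi => hMiso i (hS'j i hi) (τ i) (hiso i (hS'S i hi)))
      (fun i hi => hM'iso i (hS'j i hi) (τ i) (hiso' i (hS'S i hi))) hMnt hMirr hM'nt hM'irr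
    -- `ψ = e' ∘ (1 ⊗ ψ_M) ∘ e⁻¹`
    refine ⟨(e' : T j ⊗[k] M' →ₗ[k] Y) ∘ₗ ψM.lTensor (T j) ∘ₗ (e.symm : X →ₗ[k] T j ⊗[k] M), ?_, ?_⟩
    · exact e'.injective.comp
        (((Module.FaithfullyFlat.lTensor_injective_iff_injective k (T j) ψM).2 hψMinj).comp e.symm.injective)
    · intro i hi g x
      simp only [LinearMap.comp_apply, LinearEquiv.coe_coe]
      rcases Finset.mem_insert.1 hi with rfl | hi'
      · -- the peeled index: both `e`, `e'` transport `τ ⊗ 1`, and `1 ⊗ ψ_M` commutes with `τ ⊗ 1`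
        have h1 : e.symm (ρ i g x) = (τ i g).rTensor M (e.symm x) := by
          apply e.injective; rw [heq_j, e.apply_symm_apply, e.apply_symm_apply]
        rw [h1, ← LinearMap.comp_apply (ψM.lTensor (T i)), LinearMap.lTensor_comp_rTensor,
          ← LinearMap.rTensor_comp_lTensor, LinearMap.comp_apply, heq'_j]
      · have hij : i ≠ j := ne_of_mem_of_not_mem hi' hj
        have h1 : e.symm (ρ i g x) = (ρM i g).lTensor (T j) (e.symm x) := by
          apply e.injective; rw [heq_i i hij, e.apply_symm_apply, e.apply_symm_apply]
        have h2 : ψM ∘ₗ ρM i g = ρM' i g ∘ₗ ψM := LinearMap.ext fun m => hψM i hi' g m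
        rw [h1, ← LinearMap.comp_apply (ψM.lTensor (T j)), ← LinearMap.lTensor_comp, h2, LinearMap.lTensor_comp,
          LinearMap.comp_apply, heq'_i i hij]

end Literature.RepresentationTheory

end
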